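import Literature.NumberTheory.EllipticCurves.FormalGroupChartLevel
import Literature.NumberTheory.EllipticCurves.UnramifiedFormalGroupH1Proofs
import HarnessLib

/-!
# The limit logarithm on the kernel of reduction over a complete valued field, from the chart
# calculus (Silverman, *AEC* IV.5–IV.6 / VII.2.2 made quantitative and power-series-free), I

`Proofs` file (theorems only, no definitions, no named facts) in topic
`NumberTheory/EllipticCurves`, a sibling of `FormalGroupChart` / `FormalGroupChartLevel` /
`UnramifiedFormalGroupH1Proofs`; continued in `FormalGroupChartLimitLogEquivarianceProofs`.
Setting: a field `K` with a valuation `w : Valuation K ℝ≥0`, a `w`-integral Weierstrass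
equation `V` (`V.IsIntegral w.integer`), its kernel of reduction `E₁ = FormalGroupChart.kernel w V`
with the parameter `z = -x/y` (`Affine.Point.zCoord`), and a natural number `p` with
`0 < |p| < 1` in `K` (any such `p`; in the applications the residue characteristic).  On the level
subgroup `E⁽ᵖ⁾ = FormalGroupChart.level w V |p| = {P ∈ E₁ : |z(P)| ≤ |p|}` — which is ALL of
`E₁` under the unramified normalisation `|x| < 1 ⇒ |x| ≤ |p|` (part II,
`level_val_natCast_eq_kernel`) — the classical formal logarithm is obtained WITHOUT power series
as the limit

  `ℓ(P) = lim_r z(pʳ·P) / pʳ`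

(the sequence is `|p|`-adically Cauchy with step `≤ |p|^{r+1}` by the first-order additivity
`|z(n·Q) − n·z(Q)| ≤ |z(Q)|²` of the chart calculus).  This file proves: the estimates on
multiples (`val_zCoord_nsmul_sub_le`, `val_zCoord_pow_smul_le`, the Cauchy step
`val_approx_succ_sub_le_pow`, the total deviation `val_approx_sub_zCoord_le`); uniqueness of
`|p|`-adic limits; EXISTENCE of a function `ℓ` with the defining approximation property

  (SPEC) `∀ Q ∈ E⁽ᵖ⁾, ∀ r, |ℓ(Q) − z(pʳ·Q)/pʳ| ≤ |p|^{r+1}`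

under the completeness hypothesis of the layer files (`hcomplete`: every sequence with
`|x_{r+1} − x_r| ≤ |p|^{r+1}` has a limit `y` with `|y − x_r| ≤ |p|^{r+1}`; discharged in the tree
for the unramified layers `K_v(ζ_{qⁿ−1}) ⊂ K̄_v`, `UnramifiedCoboundaryInputs`, and for complete
nonarchimedean normed fields in part II); and, for ANY `ℓ` with (SPEC): uniqueness on `E⁽ᵖ⁾`
(`limitLog_unique`, `limitLog_eq_of_forall_val_sub_approx_le`),
`|ℓ(Q) − z(Q)| ≤ |z(Q)|²/|p|`, hence `|ℓ(Q)| ≤ |z(Q)| ≤ |p|` — **integrality `ℓ(E⁽ᵖ⁾) ⊆ p𝒪`** —,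
`|ℓ(Q)| = |z(Q)|` strictly inside the level, and **additivity `ℓ(P + Q) = ℓ(P) + ℓ(Q)`**.
Part II: `ℓ(O)`, `ℓ(−P)`, sums, the kernel, the characterisation of `ℓ` by additivity + the
quadratic estimate, Galois equivariance and the norm-to-trace formula, complete normed fields.

Motivation (cell `bsd-addord`, crux `KatoKuriharaPortThreeShared`, residual clause (C1.c) =
SAT₀): the E-side input "log_ω on `E₁(K_w)` is `𝒪`-integral, additive, Galois-equivariant and
turns norms into traces" over the UNRAMIFIED completions `K_w = ℚ₃(ζ_m)`; the tree's logarithm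
layer (`PadicPointsFiltration*`, `Additive/PadicLogImage`) is `ℚ_[p]`-only, while the chart
calculus `FormalGroupChart` is valued-field-general — these two files are the missing piece.

## Sources

* [SilvermanAEC2009] J. H. Silverman, *The Arithmetic of Elliptic Curves*, 2nd ed., GTM 106
  (2009): IV.1–IV.3 (the chart `z = −x/y`, `[m](z) = mz + …`, the filtration), IV.5–IV.6
  (the formal logarithm, Thm. IV.6.4: `log : Ê(𝓜ʳ) ≅ 𝓜ʳ` for `r > v(p)/(p−1)`),
  Prop. VII.2.2 (`E₁(K) ≅ Ê(𝓜)`).  The limit formula `log = lim [pʳ]/pʳ` is the standard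
  power-series-free route (as in the tree's `PadicPointsFiltration` over `ℚ_p`). [folklore]

## Design

* No definitions: the logarithm is delivered as `∃ ℓ, (SPEC)` plus theorems about every `ℓ`
  with (SPEC) (hypothesis `hℓ` spelled out each time), so that a review-lane `def` introduced
  later — or the identification with `WeierstrassCurve.padicLimitLog` on `ℚ_p`-points — costs one
  application of the uniqueness / characterisation theorems.
* No unramifiedness is used by the analysis: everything is stated on the level `E⁽ᵖ⁾`.
* NOT here: surjectivity of `ℓ : E⁽ᵖ⁾ → p𝒪` (needs Hensel, cf. `hlift` of the layer files), the
  extension of `ℓ` to `E₀` (reduction layer, `ReductionHomomorphism*`), the identification with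
  the integral of the invariant differential, `p`-adic fields specifically.
  `noncomputable section`, `open scoped Classical NNReal`; axioms standard.
-/

noncomputable section

open scoped Classical NNReal

namespace Literature.NumberTheory.EllipticCurves.FormalGroupChart

/-! ### Multiples in the chart: `z(n·Q) ≡ n·z(Q)` to second order, and the `p`-power tower -/

section Multiples

variable {K : Type*} [Field K] {w : Valuation K ℝ≥0} {V : WeierstrassCurve K}
  [hV : V.IsIntegral w.integer]

/-- `|z(n·Q)| ≤ |z(Q)|` on `E₁` (the level sets of `z` are subgroups).
[cite: SilvermanAEC2009, Prop. IV.3.2(a) with Prop. VII.2.2] -/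
theorem val_zCoord_nsmul_le {Q : V.toAffine.Point} (hQ : Q ∈ kernel w V) (n : ℕ) :
    w (n • Q).zCoord ≤ w Q.zCoord := by
  have h := val_zCoord_sum_sub_sum_le (w := w) (V := V) (Finset.range n) (fun _ ↦ Q)
    (fun _ _ ↦ hQ) (t := w Q.zCoord) (fun _ _ ↦ le_rfl)
  simp only [Finset.sum_const, Finset.card_range] at h
  exact h.2.1

/-- **`|z(n·Q) − n·z(Q)| ≤ |z(Q)|²` on `E₁`**: the multiplication-by-`n` map of the formal
group is `[n](z) = n z + (deg ≥ 2)` (Silverman, *AEC* IV.2.3 / Prop. IV.2.3(a)), read on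
points through `z = −x/y`; here a direct consequence of the first-order additivity of `z`
(`val_zCoord_sum_sub_sum_le` with a constant family). [cite: SilvermanAEC2009, Prop. IV.2.3 with Prop. VII.2.2] -/
theorem val_zCoord_nsmul_sub_le {Q : V.toAffine.Point} (hQ : Q ∈ kernel w V) (n : ℕ) :
    w ((n • Q).zCoord - n * Q.zCoord) ≤ w Q.zCoord ^ 2 := by
  have h := val_zCoord_sum_sub_sum_le (w := w) (V := V) (Finset.range n) (fun _ ↦ Q)
    (fun _ _ ↦ hQ) (t := w Q.zCoord) (fun _ _ ↦ le_rfl)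
  simp only [Finset.sum_const, Finset.card_range, nsmul_eq_mul] at h
  exact h.2.2

/-- **`|z(p·Q)| ≤ |p|·|z(Q)|` as soon as `|z(Q)| ≤ |p|`**: from `z(p·Q) = p·z(Q) + O(z(Q)²)`
and `|z(Q)|² ≤ |p|·|z(Q)|` (Silverman, *AEC* IV.3.2(b)/IV.6: `[p]` contracts `Ê(𝓜ʳ)` by `|p|`
in the range where the logarithm converges). [cite: SilvermanAEC2009, Prop. IV.2.3 and Prop. IV.3.2] -/
theorem val_zCoord_natCast_smul_le {Q : V.toAffine.Point} (hQ : Q ∈ kernel w V) {p : ℕ}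
    (hQp : w Q.zCoord ≤ w (p : K)) : w (p • Q).zCoord ≤ w (p : K) * w Q.zCoord := by
  have h1 : w ((p • Q).zCoord - p * Q.zCoord) ≤ w (p : K) * w Q.zCoord :=
    (val_zCoord_nsmul_sub_le hQ p).trans (by rw [pow_two]; exact mul_le_mul' hQp le_rfl)
  have h2 : w ((p : K) * Q.zCoord) ≤ w (p : K) * w Q.zCoord := by rw [map_mul]
  have e : (p • Q).zCoord = ((p • Q).zCoord - p * Q.zCoord) + p * Q.zCoord := by ring
  rw [e]
  exact w.map_add_le h1 h2

/-- **`|z(pᵏ·Q)| ≤ |p|ᵏ·|z(Q)|` for `|z(Q)| ≤ |p|`** (iterate the previous estimate; the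
hypothesis reproduces itself because `|p| ≤ 1`). [cite: SilvermanAEC2009, Prop. IV.3.2] -/
theorem val_zCoord_pow_smul_le {Q : V.toAffine.Point} (hQ : Q ∈ kernel w V) {p : ℕ}
    (hQp : w Q.zCoord ≤ w (p : K)) (k : ℕ) :
    w ((p ^ k) • Q).zCoord ≤ w (p : K) ^ k * w Q.zCoord := by
  induction k with
  | zero => simp
  | succ k ih =>
    have hR : (p ^ k) • Q ∈ kernel w V := (kernel w V).nsmul_mem hQ _
    have hRp : w ((p ^ k) • Q).zCoord ≤ w (p : K) := ih.trans <| by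
      calc w (p : K) ^ k * w Q.zCoord ≤ 1 * w (p : K) :=
            mul_le_mul' (pow_le_one₀ zero_le (val_natCast_le_one w p)) hQp
        _ = w (p : K) := one_mul _
    rw [pow_succ, mul_nsmul]
    calc w (p • (p ^ k) • Q).zCoord ≤ w (p : K) * w ((p ^ k) • Q).zCoord :=
          val_zCoord_natCast_smul_le hR hRp
      _ ≤ w (p : K) * (w (p : K) ^ k * w Q.zCoord) := by gcongr
      _ = w (p : K) ^ (k + 1) * w Q.zCoord := by ring

/-- The `pᵏ`-multiples of a point of the level `E⁽ᵖ⁾` stay in `E₁` with `|z| ≤ |p|^{k+1}`.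
[cite: SilvermanAEC2009, Prop. IV.3.2] -/
theorem pow_smul_mem_kernel_and_val_le {Q : V.toAffine.Point} (hQ : Q ∈ kernel w V) {p : ℕ}
    (hQp : w Q.zCoord ≤ w (p : K)) (k : ℕ) :
    (p ^ k) • Q ∈ kernel w V ∧ w ((p ^ k) • Q).zCoord ≤ w (p : K) ^ (k + 1) :=
  ⟨(kernel w V).nsmul_mem hQ _, (val_zCoord_pow_smul_le hQ hQp k).trans <| by
    rw [pow_succ]; exact mul_le_mul' le_rfl hQp⟩

/-- **The Cauchy step, sharp form**: with `x_r = z(pʳ·Q)/pʳ`,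
`|x_{r+1} − x_r| ≤ (|p|ʳ|z(Q)|)² / |p|^{r+1}` (since `x_{r+1} − x_r = (z(p·R) − p·z(R))/p^{r+1}`
for `R = pʳ·Q`). [cite: SilvermanAEC2009, Prop. IV.2.3 and Prop. IV.3.2] -/
theorem val_approx_succ_sub_le {Q : V.toAffine.Point} (hQ : Q ∈ kernel w V) {p : ℕ}
    (hp0 : (p : K) ≠ 0) (hQp : w Q.zCoord ≤ w (p : K)) (r : ℕ) :
    w (((p ^ (r + 1)) • Q).zCoord / (p : K) ^ (r + 1) - ((p ^ r) • Q).zCoord / (p : K) ^ r) ≤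
      (w (p : K) ^ r * w Q.zCoord) ^ 2 / w (p : K) ^ (r + 1) := by
  set R := (p ^ r) • Q with hR
  have hRK : R ∈ kernel w V := (kernel w V).nsmul_mem hQ _
  have hRz : w R.zCoord ≤ w (p : K) ^ r * w Q.zCoord := val_zCoord_pow_smul_le hQ hQp r
  have hsmul : (p ^ (r + 1)) • Q = p • R := by rw [hR, ← mul_nsmul, ← pow_succ]
  have hpr : (p : K) ^ r ≠ 0 := pow_ne_zero _ hp0
  have hpr1 : (p : K) ^ (r + 1) ≠ 0 := pow_ne_zero _ hp0
  have e : (p • R).zCoord / (p : K) ^ (r + 1) - R.zCoord / (p : K) ^ r =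
      ((p • R).zCoord - p * R.zCoord) / (p : K) ^ (r + 1) := by
    field_simp
    ring
  rw [hsmul, e, map_div₀, map_pow]
  gcongr
  exact (val_zCoord_nsmul_sub_le hRK p).trans (by gcongr)

/-- **The Cauchy step, geometric form**: for `Q ∈ E⁽ᵖ⁾` the sequence `x_r = z(pʳ·Q)/pʳ` has
`|x_{r+1} − x_r| ≤ |p|^{r+1}` — exactly the shape of the completeness hypothesis `hcomplete` of
`UnramifiedFormalGroupH1Proofs.exists_map_sub_eq_of_sum_eq_zero`.
[cite: SilvermanAEC2009, Prop. IV.3.2 and Thm. IV.6.4] -/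
theorem val_approx_succ_sub_le_pow {Q : V.toAffine.Point} (hQ : Q ∈ kernel w V) {p : ℕ}
    (hp0 : (p : K) ≠ 0) (hQp : w Q.zCoord ≤ w (p : K)) (r : ℕ) :
    w (((p ^ (r + 1)) • Q).zCoord / (p : K) ^ (r + 1) - ((p ^ r) • Q).zCoord / (p : K) ^ r) ≤
      w (p : K) ^ (r + 1) := by
  have hp : 0 < w (p : K) := (Valuation.pos_iff w).mpr hp0
  refine (val_approx_succ_sub_le hQ hp0 hQp r).trans ?_
  rw [div_le_iff₀ (pow_pos hp _)]
  calc (w (p : K) ^ r * w Q.zCoord) ^ 2 ≤ (w (p : K) ^ r * w (p : K)) ^ 2 := by gcongr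
    _ = w (p : K) ^ (r + 1) * w (p : K) ^ (r + 1) := by ring

/-- **Total deviation**: `|z(pʳ·Q)/pʳ − z(Q)| ≤ |z(Q)|²/|p|` for every `r` (ultrametric
telescoping of the Cauchy steps). [cite: SilvermanAEC2009, Thm. IV.6.4] -/
theorem val_approx_sub_zCoord_le {Q : V.toAffine.Point} (hQ : Q ∈ kernel w V) {p : ℕ}
    (hp0 : (p : K) ≠ 0) (hQp : w Q.zCoord ≤ w (p : K)) (r : ℕ) :
    w (((p ^ r) • Q).zCoord / (p : K) ^ r - Q.zCoord) ≤ w Q.zCoord ^ 2 / w (p : K) := by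
  have hp : 0 < w (p : K) := (Valuation.pos_iff w).mpr hp0
  have hp1 : w (p : K) ≤ 1 := val_natCast_le_one w p
  induction r with
  | zero => simp
  | succ r ih =>
    have e : ((p ^ (r + 1)) • Q).zCoord / (p : K) ^ (r + 1) - Q.zCoord =
        (((p ^ (r + 1)) • Q).zCoord / (p : K) ^ (r + 1) - ((p ^ r) • Q).zCoord / (p : K) ^ r) +
          (((p ^ r) • Q).zCoord / (p : K) ^ r - Q.zCoord) := by ring
    rw [e]
    refine w.map_add_le ((val_approx_succ_sub_le hQ hp0 hQp r).trans ?_) ih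
    rw [div_le_div_iff₀ (pow_pos hp _) hp]
    calc (w (p : K) ^ r * w Q.zCoord) ^ 2 * w (p : K)
        = w Q.zCoord ^ 2 * (w (p : K) ^ (r + 1) * w (p : K) ^ r) := by ring
      _ ≤ w Q.zCoord ^ 2 * (w (p : K) ^ (r + 1) * 1) := by
          gcongr; exact pow_le_one₀ zero_le hp1
      _ = w Q.zCoord ^ 2 * w (p : K) ^ (r + 1) := by rw [mul_one]

end Multiples

/-! ### Limits: uniqueness, and existence under completeness -/

section Limit

variable {K : Type*} [Field K] {w : Valuation K ℝ≥0}

/-- A value bounded by `max(ρ^{r+1}, c)` for every `r`, with `ρ < 1`, is bounded by `c`.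
[folklore] -/
private theorem val_le_of_forall_le_max_pow {ρ c : ℝ≥0} (hρ1 : ρ < 1) {a : K}
    (h : ∀ r : ℕ, w a ≤ max (ρ ^ (r + 1)) c) : w a ≤ c := by
  by_contra hc
  have hc' : c < w a := lt_of_not_ge hc
  have hpos : 0 < w a := lt_of_le_of_lt zero_le hc'
  obtain ⟨r, hr⟩ := exists_pow_lt_of_lt_one hpos hρ1
  have h1 : ρ ^ (r + 1) ≤ ρ ^ r := pow_le_pow_right_of_le_one' hρ1.le (Nat.le_succ r)
  have h2 : max (ρ ^ (r + 1)) c < w a := max_lt (h1.trans_lt hr) hc'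
  exact lt_irrefl _ ((h r).trans_lt h2)

/-- **Uniqueness of `ρ`-adic limits**: if `|y − x_r| ≤ ρ^{r+1}` and `|y′ − x_r| ≤ ρ^{r+1}` for
all `r` (`ρ < 1`), then `y = y′`. [folklore] -/
private theorem eq_of_forall_val_sub_le_pow {ρ : ℝ≥0} (hρ1 : ρ < 1) {x : ℕ → K} {y y' : K}
    (hy : ∀ r, w (y - x r) ≤ ρ ^ (r + 1)) (hy' : ∀ r, w (y' - x r) ≤ ρ ^ (r + 1)) : y = y' := by
  have h : w (y - y') ≤ 0 := by
    refine val_le_of_forall_le_max_pow hρ1 fun r ↦ ?_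
    have e : y - y' = (y - x r) - (y' - x r) := by ring
    rw [e]
    exact (Valuation.map_sub w _ _).trans ((max_le (hy r) (hy' r)).trans (le_max_left _ _))
  have h0 : w (y - y') = 0 := le_antisymm h zero_le
  rwa [Valuation.zero_iff, sub_eq_zero] at h0

variable {V : WeierstrassCurve K} [hV : V.IsIntegral w.integer]

/-- **Existence of the limit of `z(pʳ·Q)/pʳ` for `Q ∈ E⁽ᵖ⁾` under completeness** (`hcomplete` in
the shape of the layer files: every sequence with `|x_{r+1} − x_r| ≤ |p|^{r+1}` has a limit `y`
with `|y − x_r| ≤ |p|^{r+1}`). [cite: SilvermanAEC2009, Thm. IV.6.4 with Prop. VII.2.2] -/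
theorem exists_forall_val_sub_approx_le {p : ℕ} (hp0 : (p : K) ≠ 0)
    (hcomplete : ∀ x : ℕ → K, (∀ r, w (x (r + 1) - x r) ≤ w (p : K) ^ (r + 1)) →
      ∃ y : K, ∀ r, w (y - x r) ≤ w (p : K) ^ (r + 1))
    {Q : V.toAffine.Point} (hQ : Q ∈ kernel w V) (hQp : w Q.zCoord ≤ w (p : K)) :
    ∃ y : K, ∀ r, w (y - ((p ^ r) • Q).zCoord / (p : K) ^ r) ≤ w (p : K) ^ (r + 1) :=
  hcomplete (fun r ↦ ((p ^ r) • Q).zCoord / (p : K) ^ r)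
    (fun r ↦ val_approx_succ_sub_le_pow hQ hp0 hQp r)

/-- **Existence of a limit logarithm on the level `E⁽ᵖ⁾`** under completeness: a function `ℓ`
on points with the defining approximation property
(SPEC) `|ℓ(Q) − z(pʳ·Q)/pʳ| ≤ |p|^{r+1}` for all `Q ∈ E⁽ᵖ⁾ = level w V |p|` and all `r`
(junk value `0` off `E⁽ᵖ⁾`).  Every further property below is proved for ANY `ℓ` with (SPEC).
[cite: SilvermanAEC2009, IV.5–IV.6 (the formal logarithm) with Prop. VII.2.2] -/
theorem exists_limitLog {p : ℕ} (hp0 : (p : K) ≠ 0)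
    (hcomplete : ∀ x : ℕ → K, (∀ r, w (x (r + 1) - x r) ≤ w (p : K) ^ (r + 1)) →
      ∃ y : K, ∀ r, w (y - x r) ≤ w (p : K) ^ (r + 1)) :
    ∃ ℓ : V.toAffine.Point → K, ∀ Q ∈ level w V (w (p : K)), ∀ r : ℕ,
      w (ℓ Q - ((p ^ r) • Q).zCoord / (p : K) ^ r) ≤ w (p : K) ^ (r + 1) := by
  refine ⟨fun Q ↦ if h : Q ∈ level w V (w (p : K)) then
    Classical.choose (exists_forall_val_sub_approx_le hp0 hcomplete h.1 h.2) else 0, ?_⟩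
  intro Q hQ r
  simp only [dif_pos hQ]
  exact Classical.choose_spec (exists_forall_val_sub_approx_le hp0 hcomplete hQ.1 hQ.2) r

end Limit

/-! ### Properties of any function with (SPEC) -/

section Spec

variable {K : Type*} [Field K] {w : Valuation K ℝ≥0} {V : WeierstrassCurve K}
  [hV : V.IsIntegral w.integer] {p : ℕ} {ℓ : V.toAffine.Point → K}

/-- **Two functions with (SPEC) agree on `E⁽ᵖ⁾`** (uniqueness of `|p|`-adic limits).
[cite: SilvermanAEC2009, Thm. IV.6.4] -/
theorem limitLog_unique (hp1 : w (p : K) < 1)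
    (hℓ : ∀ Q ∈ level w V (w (p : K)), ∀ r : ℕ,
      w (ℓ Q - ((p ^ r) • Q).zCoord / (p : K) ^ r) ≤ w (p : K) ^ (r + 1))
    {ℓ' : V.toAffine.Point → K}
    (hℓ' : ∀ Q ∈ level w V (w (p : K)), ∀ r : ℕ,
      w (ℓ' Q - ((p ^ r) • Q).zCoord / (p : K) ^ r) ≤ w (p : K) ^ (r + 1))
    {Q : V.toAffine.Point} (hQ : Q ∈ level w V (w (p : K))) : ℓ Q = ℓ' Q :=
  eq_of_forall_val_sub_le_pow hp1 (hℓ Q hQ) (hℓ' Q hQ)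

/-- **`ℓ(Q)` IS the limit of `z(pʳ·Q)/pʳ`**: any value `y` with `|y − z(pʳ·Q)/pʳ| ≤ |p|^{r+1}`
for all `r` equals `ℓ(Q)` (uniqueness of the `|p|`-adic limit defining the logarithm).
[cite: SilvermanAEC2009, Thm. IV.6.4] -/
theorem limitLog_eq_of_forall_val_sub_approx_le (hp1 : w (p : K) < 1)
    (hℓ : ∀ Q ∈ level w V (w (p : K)), ∀ r : ℕ,
      w (ℓ Q - ((p ^ r) • Q).zCoord / (p : K) ^ r) ≤ w (p : K) ^ (r + 1))
    {Q : V.toAffine.Point} (hQ : Q ∈ level w V (w (p : K))) {y : K}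
    (hy : ∀ r : ℕ, w (y - ((p ^ r) • Q).zCoord / (p : K) ^ r) ≤ w (p : K) ^ (r + 1)) :
    ℓ Q = y :=
  eq_of_forall_val_sub_le_pow hp1 (hℓ Q hQ) hy

/-- **`|ℓ(Q) − z(Q)| ≤ |z(Q)|²/|p|` on `E⁽ᵖ⁾`**: the logarithm is `z + O(z²)` with the explicit
constant (Silverman, *AEC* IV.5: `log(z) = z + …`). [cite: SilvermanAEC2009, Prop. IV.5.5 and Thm. IV.6.4] -/
theorem val_limitLog_sub_zCoord_le (hp0 : (p : K) ≠ 0) (hp1 : w (p : K) < 1)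
    (hℓ : ∀ Q ∈ level w V (w (p : K)), ∀ r : ℕ,
      w (ℓ Q - ((p ^ r) • Q).zCoord / (p : K) ^ r) ≤ w (p : K) ^ (r + 1))
    {Q : V.toAffine.Point} (hQ : Q ∈ level w V (w (p : K))) :
    w (ℓ Q - Q.zCoord) ≤ w Q.zCoord ^ 2 / w (p : K) := by
  refine val_le_of_forall_le_max_pow hp1 fun r ↦ ?_
  have e : ℓ Q - Q.zCoord = (ℓ Q - ((p ^ r) • Q).zCoord / (p : K) ^ r) +
      (((p ^ r) • Q).zCoord / (p : K) ^ r - Q.zCoord) := by ring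
  rw [e]
  exact (w.map_add _ _).trans
    (max_le_max (hℓ Q hQ r) (val_approx_sub_zCoord_le hQ.1 hp0 hQ.2 r))

/-- **`|ℓ(Q)| ≤ |z(Q)|` on `E⁽ᵖ⁾`** (from `|z(Q)|²/|p| ≤ |z(Q)|`). [cite: SilvermanAEC2009, Thm. IV.6.4] -/
theorem val_limitLog_le (hp0 : (p : K) ≠ 0) (hp1 : w (p : K) < 1)
    (hℓ : ∀ Q ∈ level w V (w (p : K)), ∀ r : ℕ,
      w (ℓ Q - ((p ^ r) • Q).zCoord / (p : K) ^ r) ≤ w (p : K) ^ (r + 1))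
    {Q : V.toAffine.Point} (hQ : Q ∈ level w V (w (p : K))) :
    w (ℓ Q) ≤ w Q.zCoord := by
  have hp : 0 < w (p : K) := (Valuation.pos_iff w).mpr hp0
  have h1 : w Q.zCoord ^ 2 / w (p : K) ≤ w Q.zCoord := by
    rw [div_le_iff₀ hp, pow_two]
    exact mul_le_mul' le_rfl hQ.2
  have e : ℓ Q = (ℓ Q - Q.zCoord) + Q.zCoord := by ring
  rw [e]
  exact w.map_add_le ((val_limitLog_sub_zCoord_le hp0 hp1 hℓ hQ).trans h1) le_rfl

/-- **Integrality: `ℓ(E⁽ᵖ⁾) ⊆ p𝒪`**, i.e. `|ℓ(Q)| ≤ |p|` for `Q ∈ E⁽ᵖ⁾` — under the unramified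
normalisation (`level_val_natCast_eq_kernel`) this is `log(E₁(K)) ⊆ p𝒪_K`, the E-side input
(E-K1) of the `bsd-addord` SAT₀ argument. [cite: SilvermanAEC2009, Thm. IV.6.4(b)] -/
theorem val_limitLog_le_val_natCast (hp0 : (p : K) ≠ 0) (hp1 : w (p : K) < 1)
    (hℓ : ∀ Q ∈ level w V (w (p : K)), ∀ r : ℕ,
      w (ℓ Q - ((p ^ r) • Q).zCoord / (p : K) ^ r) ≤ w (p : K) ^ (r + 1))
    {Q : V.toAffine.Point} (hQ : Q ∈ level w V (w (p : K))) :
    w (ℓ Q) ≤ w (p : K) :=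
  (val_limitLog_le hp0 hp1 hℓ hQ).trans hQ.2

/-- **Strict points: `|ℓ(Q)| = |z(Q)|` when `|z(Q)| < |p|`** (the logarithm is an isometry
strictly inside the level). [cite: SilvermanAEC2009, Thm. IV.6.4] -/
theorem val_limitLog_eq_of_val_lt (hp0 : (p : K) ≠ 0) (hp1 : w (p : K) < 1)
    (hℓ : ∀ Q ∈ level w V (w (p : K)), ∀ r : ℕ,
      w (ℓ Q - ((p ^ r) • Q).zCoord / (p : K) ^ r) ≤ w (p : K) ^ (r + 1))
    {Q : V.toAffine.Point} (hQ : Q ∈ level w V (w (p : K))) (hlt : w Q.zCoord < w (p : K)) :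
    w (ℓ Q) = w Q.zCoord := by
  by_cases hz : Q.zCoord = 0
  · have hQ0 : Q = 0 := (zCoord_eq_zero_iff hQ.1).mp hz
    have h := val_limitLog_le hp0 hp1 hℓ hQ
    rw [hz, map_zero] at h ⊢
    exact le_antisymm h zero_le
  · have hp : 0 < w (p : K) := (Valuation.pos_iff w).mpr hp0
    have hzpos : 0 < w Q.zCoord := (Valuation.pos_iff w).mpr hz
    have hlt' : w (ℓ Q - Q.zCoord) < w Q.zCoord := by
      refine (val_limitLog_sub_zCoord_le hp0 hp1 hℓ hQ).trans_lt ?_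
      rw [div_lt_iff₀ hp, pow_two]
      exact mul_lt_mul_of_pos_left hlt hzpos
    have e : ℓ Q = Q.zCoord + (ℓ Q - Q.zCoord) := by ring
    rw [e]
    exact Valuation.map_add_eq_of_lt_left w hlt'

/-- **Additivity: `ℓ(P + Q) = ℓ(P) + ℓ(Q)` on `E⁽ᵖ⁾`** (from `pʳ·(P + Q) = pʳ·P + pʳ·Q`, the
first-order additivity of `z` at the points `pʳ·P, pʳ·Q` of size `≤ |p|^{r+1}`, and uniqueness
of limits). [cite: SilvermanAEC2009, Prop. IV.5.5 and Thm. IV.6.4] -/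
theorem limitLog_add (hp0 : (p : K) ≠ 0) (hp1 : w (p : K) < 1)
    (hℓ : ∀ Q ∈ level w V (w (p : K)), ∀ r : ℕ,
      w (ℓ Q - ((p ^ r) • Q).zCoord / (p : K) ^ r) ≤ w (p : K) ^ (r + 1))
    {P Q : V.toAffine.Point} (hP : P ∈ level w V (w (p : K)))
    (hQ : Q ∈ level w V (w (p : K))) : ℓ (P + Q) = ℓ P + ℓ Q := by
  have hp : 0 < w (p : K) := (Valuation.pos_iff w).mpr hp0
  have hPQ : P + Q ∈ level w V (w (p : K)) := (level w V (w (p : K))).add_mem hP hQ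
  refine limitLog_eq_of_forall_val_sub_approx_le hp1 hℓ hPQ fun r ↦ ?_
  obtain ⟨hAK, hAz⟩ := pow_smul_mem_kernel_and_val_le hP.1 hP.2 r
  obtain ⟨hBK, hBz⟩ := pow_smul_mem_kernel_and_val_le hQ.1 hQ.2 r
  have hpr : (p : K) ^ r ≠ 0 := pow_ne_zero _ hp0
  have hadd := val_zCoord_add_sub_le hAK hBK
  have e : ℓ P + ℓ Q - ((p ^ r) • (P + Q)).zCoord / (p : K) ^ r =
      (ℓ P - ((p ^ r) • P).zCoord / (p : K) ^ r) + (ℓ Q - ((p ^ r) • Q).zCoord / (p : K) ^ r) -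
        (((p ^ r) • P + (p ^ r) • Q).zCoord - ((p ^ r) • P).zCoord - ((p ^ r) • Q).zCoord) /
          (p : K) ^ r := by
    rw [nsmul_add]
    field_simp
    ring
  rw [e]
  refine (Valuation.map_sub w _ _).trans (max_le (w.map_add_le (hℓ P hP r) (hℓ Q hQ r)) ?_)
  rw [map_div₀, map_pow, div_le_iff₀ (pow_pos hp _)]
  refine hadd.trans ?_
  calc max (w ((p ^ r) • P).zCoord) (w ((p ^ r) • Q).zCoord) ^ 2
      ≤ (w (p : K) ^ (r + 1)) ^ 2 := by gcongr; exact max_le hAz hBz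
    _ = w (p : K) ^ (r + 1) * w (p : K) ^ r * w (p : K) := by ring
    _ ≤ w (p : K) ^ (r + 1) * w (p : K) ^ r * 1 := mul_le_mul' le_rfl hp1.le
    _ = w (p : K) ^ (r + 1) * w (p : K) ^ r := mul_one _

end Spec

end Literature.NumberTheory.EllipticCurves.FormalGroupChart

end
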